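import Summits.Ventures.CertifiedManyBodySolver.Downfold.EmeryOrbitalWeightFaceBox
import Summits.Ventures.CertifiedManyBodySolver.Downfold.EmeryVanHoveSubBox
import Summits.Ventures.CertifiedManyBodySolver.Downfold.EmeryVanHoveTableA
import Summits.Ventures.CertifiedManyBodySolver.Downfold.EmeryVanHoveTableE
import Summits.Ventures.CertifiedManyBodySolver.Downfold.EmeryFermiFacePointsCCOCK26NH110S1
import Summits.Ventures.CertifiedManyBodySolver.Downfold.EmeryFermiFacePointsCCOCK26NH110S2
import Summits.Ventures.CertifiedManyBodySolver.Downfold.EmeryFermiFacePointsCCOCK26NH110S3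
import HarnessLib

/-!
# THE ANTINODAL FERMI-SURFACE Cu-d WEIGHT OVER THE TYPED 3BE BOX `emeryBoxCCOCK26Src (EmeryBoxesKSlicesB)` AT FILLING n_H = 1.10 (ν = 9/20) — the kinematic leg of the UPPER member `U_B∣full(w_antinode)` of the weak
# band-level `U` bracket read over a box (INFL-3to1-B §B.90; kernel `EmeryOrbitalWeightFaceBox`; router/OBJECT-E-BUDGET.tsv §C)

Venture CertifiedManyBodySolver, cell `pub/hubbard-downfold` (stage S1), seat hubbard-downfold-mod-4 (technique B, g38); namespace
`Summit.Ventures.CertifiedManyBodySolver.Downfold.Emery`. Everything PROVED (0 sorry). WHAT THIS IS NOT: a statement about the material — the typed box (Ca₂₋ₓNaₓCuO₂Cl₂ x = 0.10 ((K) #3 source box))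
is SCREENING-GRADE; `U = 0` one-body kinematics of the σ model; the `U_B` arithmetic that consumes the window is DERIVED context on the MEAN-FIELD annex (R-B17).

For every member θ = (Δ, t_pd, t_pp, t_pp′) ∈ [2.05, 2.66] × [1.17, 1.39] × [0.58, 0.69] × [0.13, 0.136] eV at filling ν = 9/20, the Cu-d weight of the ANTINODAL Bloch state (the zone-face
point of the member's own Fermi surface — the MOST Cu-like Fermi point, `EmeryOrbitalWeightMonotone`), `dWeightFace θ (fermiEnergyOf θ ν)`, lies in the window below.
DEVICE: `W(θ) = W(Δ/t_pd, 1, t_pp/t_pd, t_pp′/t_pd)` (scaling law); the t_pd range is cut into 3 slabs; on each normalised slab the THREE-COORDINATE CORNER RULE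
`dWeightFace_fermiEnergyOf_mem_Icc_of_mem_box3_num` (levers Δ ↑, t_pp ↓, t_pp′ ↑ at fixed filling; hole-likeness from the slab's `vhBoxCheck` + the Ψ table; the upper
face edge from four corner inequalities; the antinodal charge-transfer regime `4(t_pp + t_pp′) ≤ Δ + ε_F` at two corners) is read on three K = 384 Fermi-energy brackets
(`EmeryFermiFacePointsCCOCK26NH110S<k>`). The slab corners `(Δ₂/a₁, 1, b₁/a₂, c₂/a₁)` are VIRTUAL (not members): the window is a sound ENCLOSURE, a few 10⁻³ wider than the image.

| t_pd slab (eV) | normalised slab Δ/t_pd × t_pp/t_pd × t_pp′/t_pd | q₁ (vhBoxCheck) ≥ table point | E_h | E_R | E_v | regime margins (R1, R2) | **w_face window** |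
|---|---|---|---|---|---|---|---|
| [1.17, 1.24] | [1.653, 2.274] × [0.4677, 0.5897] × [0.1048, 0.1162] | 0.4607 ≥ 23/50 (Ψ ≤ 0.3984) | 1.3482 | 1.2888 | 1.1139 | +0.118, +1.051 | **[0.6912, 0.7664]** |
| [1.24, 1.31] | [1.565, 2.145] × [0.4427, 0.5565] × [0.09924, 0.1097] | 0.4458 ≥ 11/25 (Ψ ≤ 0.4012) | 1.3716 | 1.3152 | 1.1459 | +0.216, +1.081 | **[0.684, 0.756]** |
| [1.31, 1.39] | [1.475, 2.031] × [0.4173, 0.5267] × [0.09353, 0.1038] | 0.4274 ≥ 83/200 (Ψ ≤ 0.4048) | 1.3975 | 1.3414 | 1.1745 | +0.294, +1.121 | **[0.676, 0.7467]** |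
| **whole box** | (hull of the slabs) | | | | | | **[0.676, 0.7664]** |

Sources: three-band model [HybertsenSchluterChristensen1989, Eq. (1)]; face point of the bilinear contour [AndersenEtAl1995, §6]; [folklore] algebra.
-/

noncomputable section

namespace Summit.Ventures.CertifiedManyBodySolver.Downfold.Emery

open Real Set

/-- **Slab 1 (t_pd ∈ [1.17, 1.24] eV) of `emeryBoxCCOCK26Src (EmeryBoxesKSlicesB)`, ν = 9/20: the antinodal Fermi-surface Cu-d weight of every member lies in `[0.6912, 0.7664]`**
(normalised-slab corner rule; brackets `facePt_CCOCK26_nH110_s1_lo_br` / `_R_br` / `_hi_br`). [folklore] -/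
theorem cCOCK26Box_dWeightFace_nH110_s1 {Δ a b c : ℝ} (hΔ : Δ ∈ Icc ((41 : ℝ) / 20) ((133 : ℝ) / 50)) (ha : a ∈ Icc ((117 : ℝ) / 100) ((31 : ℝ) / 25)) (hb : b ∈ Icc ((29 : ℝ) / 50) ((69 : ℝ) / 100)) (hc : c ∈ Icc ((13 : ℝ) / 100) ((17 : ℝ) / 125)) :
    dWeightFace Δ a b c (fermiEnergyOf Δ a b c ((9 : ℝ) / 20)) ∈ Icc ((432 : ℝ) / 625) ((479 : ℝ) / 625) := by
  have ha0 : 0 < a := lt_of_lt_of_le (by norm_num) ha.1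
  rw [dWeightFace_fermiEnergyOf_eq_ratios ha0]
  have hΔn : Δ / a ∈ Icc ((205 : ℝ) / 124) ((266 : ℝ) / 117) := by
    constructor
    · rw [le_div_iff₀ ha0]; linarith [hΔ.1, ha.2]
    · rw [div_le_iff₀ ha0]; linarith [hΔ.2, ha.1]
  have hbn : b / a ∈ Icc ((29 : ℝ) / 62) ((23 : ℝ) / 39) := by
    constructor
    · rw [le_div_iff₀ ha0]; linarith [hb.1, ha.2]
    · rw [div_le_iff₀ ha0]; linarith [hb.2, ha.1]
  have hcn : c / a ∈ Icc ((13 : ℝ) / 124) ((68 : ℝ) / 585) := by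
    constructor
    · rw [le_div_iff₀ ha0]; linarith [hc.1, ha.2]
    · rw [div_le_iff₀ ha0]; linarith [hc.2, ha.1]
  have hVH : ∀ Δ' b' c' : ℝ, Δ' ∈ Icc ((205 : ℝ) / 124) ((266 : ℝ) / 117) → b' ∈ Icc ((29 : ℝ) / 62) ((23 : ℝ) / 39) → c' ∈ Icc ((13 : ℝ) / 124) ((68 : ℝ) / 585) →
      1 - 2 * ((9 : ℝ) / 20) ≤ xVH Δ' 1 b' c' := by
    intro Δ' b' c' hΔ' hb' hc'
    have h := xVH_window_of_vhBoxCheck (Δ₁ := ((205 : ℚ) / 124)) (Δ₂ := ((266 : ℚ) / 117)) (a₁ := (1 : ℚ)) (a₂ := (1 : ℚ)) (b₁ := ((29 : ℚ) / 62)) (b₂ := ((23 : ℚ) / 39))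
      (c₁ := ((13 : ℚ) / 124)) (c₂ := ((68 : ℚ) / 585)) (v₁ := ((2109 : ℚ) / 2000)) (v₂ := ((12163 : ℚ) / 10000)) (e := ((301 : ℚ) / 250)) (E := ((5323 : ℚ) / 5000))
      (q₁ := ((4607 : ℚ) / 10000)) (q₂ := ((923 : ℚ) / 1250)) (by decide +kernel)
      (Δ := Δ') (tpd := 1) (tpp := b') (c := c') (by simpa using hΔ') (by simp) (by simpa using hb') (by simpa using hc')
    obtain ⟨-, -, -, -, -, hwin⟩ := h
    push_cast at hwin
    have ht := vhFrac_23_50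
    have hmono := vhFrac_anti (show (23 / 50 : ℝ) ≤ ((4607 : ℝ) / 10000) by norm_num)
    have hnu : ((58749 : ℝ) / 147456) ≤ ((9 : ℝ) / 20) := by norm_num
    linarith [hwin.1, ht.2]
  have hEh := (fermiEnergyOf_of_pointBracketCheck facePt_CCOCK26_nH110_s1_lo_br (by norm_num) (by norm_num) (by norm_num) (ν := (9/20 : ℝ))
    (by push_cast; exact ⟨le_rfl, le_rfl⟩)).2
  have hER := (fermiEnergyOf_of_pointBracketCheck facePt_CCOCK26_nH110_s1_R_br (by norm_num) (by norm_num) (by norm_num) (ν := (9/20 : ℝ))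
    (by push_cast; exact ⟨le_rfl, le_rfl⟩)).2
  have hEv := (fermiEnergyOf_of_pointBracketCheck facePt_CCOCK26_nH110_s1_hi_br (by norm_num) (by norm_num) (by norm_num) (ν := (9/20 : ℝ))
    (by push_cast; exact ⟨le_rfl, le_rfl⟩)).2
  push_cast at hEh hER hEv
  exact dWeightFace_fermiEnergyOf_mem_Icc_of_mem_box3_num (Eh := ((6741 : ℝ) / 5000)) (ER := ((1611 : ℝ) / 1250)) (Ev := ((11139 : ℝ) / 10000))
    (by norm_num) one_pos (by norm_num) (by norm_num) hΔn hbn hcn (by norm_num) (by norm_num) hVH hEh.2 (by norm_num)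
    (by norm_num [faceU, fsD, fsN, cA]) (by norm_num [faceU, fsD, fsN, cA]) (by norm_num [faceU, fsD, fsN, cA]) (by norm_num [faceU, fsD, fsN, cA])
    hER.1 (by norm_num) hEv.1 (by norm_num) (by norm_num) (by norm_num [faceG])
    (by norm_num [dWeightFaceCF, faceN, faceR, fsN]) (by norm_num [dWeightFaceCF, faceN, faceR, fsN])

/-- **Slab 2 (t_pd ∈ [1.24, 1.31] eV) of `emeryBoxCCOCK26Src (EmeryBoxesKSlicesB)`, ν = 9/20: the antinodal Fermi-surface Cu-d weight of every member lies in `[0.684, 0.756]`**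
(normalised-slab corner rule; brackets `facePt_CCOCK26_nH110_s2_lo_br` / `_R_br` / `_hi_br`). [folklore] -/
theorem cCOCK26Box_dWeightFace_nH110_s2 {Δ a b c : ℝ} (hΔ : Δ ∈ Icc ((41 : ℝ) / 20) ((133 : ℝ) / 50)) (ha : a ∈ Icc ((31 : ℝ) / 25) ((131 : ℝ) / 100)) (hb : b ∈ Icc ((29 : ℝ) / 50) ((69 : ℝ) / 100)) (hc : c ∈ Icc ((13 : ℝ) / 100) ((17 : ℝ) / 125)) :
    dWeightFace Δ a b c (fermiEnergyOf Δ a b c ((9 : ℝ) / 20)) ∈ Icc ((171 : ℝ) / 250) ((189 : ℝ) / 250) := by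
  have ha0 : 0 < a := lt_of_lt_of_le (by norm_num) ha.1
  rw [dWeightFace_fermiEnergyOf_eq_ratios ha0]
  have hΔn : Δ / a ∈ Icc ((205 : ℝ) / 131) ((133 : ℝ) / 62) := by
    constructor
    · rw [le_div_iff₀ ha0]; linarith [hΔ.1, ha.2]
    · rw [div_le_iff₀ ha0]; linarith [hΔ.2, ha.1]
  have hbn : b / a ∈ Icc ((58 : ℝ) / 131) ((69 : ℝ) / 124) := by
    constructor
    · rw [le_div_iff₀ ha0]; linarith [hb.1, ha.2]
    · rw [div_le_iff₀ ha0]; linarith [hb.2, ha.1]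
  have hcn : c / a ∈ Icc ((13 : ℝ) / 131) ((17 : ℝ) / 155) := by
    constructor
    · rw [le_div_iff₀ ha0]; linarith [hc.1, ha.2]
    · rw [div_le_iff₀ ha0]; linarith [hc.2, ha.1]
  have hVH : ∀ Δ' b' c' : ℝ, Δ' ∈ Icc ((205 : ℝ) / 131) ((133 : ℝ) / 62) → b' ∈ Icc ((58 : ℝ) / 131) ((69 : ℝ) / 124) → c' ∈ Icc ((13 : ℝ) / 131) ((17 : ℝ) / 155) →
      1 - 2 * ((9 : ℝ) / 20) ≤ xVH Δ' 1 b' c' := by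
    intro Δ' b' c' hΔ' hb' hc'
    have h := xVH_window_of_vhBoxCheck (Δ₁ := ((205 : ℚ) / 131)) (Δ₂ := ((133 : ℚ) / 62)) (a₁ := (1 : ℚ)) (a₂ := (1 : ℚ)) (b₁ := ((58 : ℚ) / 131)) (b₂ := ((69 : ℚ) / 124))
      (c₁ := ((13 : ℚ) / 131)) (c₂ := ((17 : ℚ) / 155)) (v₁ := ((1089 : ℚ) / 1000)) (v₂ := ((12467 : ℚ) / 10000)) (e := ((247 : ℚ) / 200)) (E := ((10987 : ℚ) / 10000))
      (q₁ := ((2229 : ℚ) / 5000)) (q₂ := ((7023 : ℚ) / 10000)) (by decide +kernel)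
      (Δ := Δ') (tpd := 1) (tpp := b') (c := c') (by simpa using hΔ') (by simp) (by simpa using hb') (by simpa using hc')
    obtain ⟨-, -, -, -, -, hwin⟩ := h
    push_cast at hwin
    have ht := vhFrac_11_25
    have hmono := vhFrac_anti (show (11 / 25 : ℝ) ≤ ((2229 : ℝ) / 5000) by norm_num)
    have hnu : ((59152 : ℝ) / 147456) ≤ ((9 : ℝ) / 20) := by norm_num
    linarith [hwin.1, ht.2]
  have hEh := (fermiEnergyOf_of_pointBracketCheck facePt_CCOCK26_nH110_s2_lo_br (by norm_num) (by norm_num) (by norm_num) (ν := (9/20 : ℝ))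
    (by push_cast; exact ⟨le_rfl, le_rfl⟩)).2
  have hER := (fermiEnergyOf_of_pointBracketCheck facePt_CCOCK26_nH110_s2_R_br (by norm_num) (by norm_num) (by norm_num) (ν := (9/20 : ℝ))
    (by push_cast; exact ⟨le_rfl, le_rfl⟩)).2
  have hEv := (fermiEnergyOf_of_pointBracketCheck facePt_CCOCK26_nH110_s2_hi_br (by norm_num) (by norm_num) (by norm_num) (ν := (9/20 : ℝ))
    (by push_cast; exact ⟨le_rfl, le_rfl⟩)).2
  push_cast at hEh hER hEv
  exact dWeightFace_fermiEnergyOf_mem_Icc_of_mem_box3_num (Eh := ((3429 : ℝ) / 2500)) (ER := ((822 : ℝ) / 625)) (Ev := ((11459 : ℝ) / 10000))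
    (by norm_num) one_pos (by norm_num) (by norm_num) hΔn hbn hcn (by norm_num) (by norm_num) hVH hEh.2 (by norm_num)
    (by norm_num [faceU, fsD, fsN, cA]) (by norm_num [faceU, fsD, fsN, cA]) (by norm_num [faceU, fsD, fsN, cA]) (by norm_num [faceU, fsD, fsN, cA])
    hER.1 (by norm_num) hEv.1 (by norm_num) (by norm_num) (by norm_num [faceG])
    (by norm_num [dWeightFaceCF, faceN, faceR, fsN]) (by norm_num [dWeightFaceCF, faceN, faceR, fsN])

/-- **Slab 3 (t_pd ∈ [1.31, 1.39] eV) of `emeryBoxCCOCK26Src (EmeryBoxesKSlicesB)`, ν = 9/20: the antinodal Fermi-surface Cu-d weight of every member lies in `[0.676, 0.7467]`**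
(normalised-slab corner rule; brackets `facePt_CCOCK26_nH110_s3_lo_br` / `_R_br` / `_hi_br`). [folklore] -/
theorem cCOCK26Box_dWeightFace_nH110_s3 {Δ a b c : ℝ} (hΔ : Δ ∈ Icc ((41 : ℝ) / 20) ((133 : ℝ) / 50)) (ha : a ∈ Icc ((131 : ℝ) / 100) ((139 : ℝ) / 100)) (hb : b ∈ Icc ((29 : ℝ) / 50) ((69 : ℝ) / 100)) (hc : c ∈ Icc ((13 : ℝ) / 100) ((17 : ℝ) / 125)) :
    dWeightFace Δ a b c (fermiEnergyOf Δ a b c ((9 : ℝ) / 20)) ∈ Icc ((169 : ℝ) / 250) ((7467 : ℝ) / 10000) := by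
  have ha0 : 0 < a := lt_of_lt_of_le (by norm_num) ha.1
  rw [dWeightFace_fermiEnergyOf_eq_ratios ha0]
  have hΔn : Δ / a ∈ Icc ((205 : ℝ) / 139) ((266 : ℝ) / 131) := by
    constructor
    · rw [le_div_iff₀ ha0]; linarith [hΔ.1, ha.2]
    · rw [div_le_iff₀ ha0]; linarith [hΔ.2, ha.1]
  have hbn : b / a ∈ Icc ((58 : ℝ) / 139) ((69 : ℝ) / 131) := by
    constructor
    · rw [le_div_iff₀ ha0]; linarith [hb.1, ha.2]
    · rw [div_le_iff₀ ha0]; linarith [hb.2, ha.1]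
  have hcn : c / a ∈ Icc ((13 : ℝ) / 139) ((68 : ℝ) / 655) := by
    constructor
    · rw [le_div_iff₀ ha0]; linarith [hc.1, ha.2]
    · rw [div_le_iff₀ ha0]; linarith [hc.2, ha.1]
  have hVH : ∀ Δ' b' c' : ℝ, Δ' ∈ Icc ((205 : ℝ) / 139) ((266 : ℝ) / 131) → b' ∈ Icc ((58 : ℝ) / 139) ((69 : ℝ) / 131) → c' ∈ Icc ((13 : ℝ) / 139) ((68 : ℝ) / 655) →
      1 - 2 * ((9 : ℝ) / 20) ≤ xVH Δ' 1 b' c' := by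
    intro Δ' b' c' hΔ' hb' hc'
    have h := xVH_window_of_vhBoxCheck (Δ₁ := ((205 : ℚ) / 139)) (Δ₂ := ((266 : ℚ) / 131)) (a₁ := (1 : ℚ)) (a₂ := (1 : ℚ)) (b₁ := ((58 : ℚ) / 139)) (b₂ := ((69 : ℚ) / 131))
      (c₁ := ((13 : ℚ) / 139)) (c₂ := ((68 : ℚ) / 655)) (v₁ := ((11213 : ℚ) / 10000)) (v₂ := ((12789 : ℚ) / 10000)) (e := ((12669 : ℚ) / 10000)) (E := ((11313 : ℚ) / 10000))
      (q₁ := ((2137 : ℚ) / 5000)) (q₂ := ((1679 : ℚ) / 2500)) (by decide +kernel)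
      (Δ := Δ') (tpd := 1) (tpp := b') (c := c') (by simpa using hΔ') (by simp) (by simpa using hb') (by simpa using hc')
    obtain ⟨-, -, -, -, -, hwin⟩ := h
    push_cast at hwin
    have ht := vhFrac_83_200
    have hmono := vhFrac_anti (show (83 / 200 : ℝ) ≤ ((2137 : ℝ) / 5000) by norm_num)
    have hnu : ((59683 : ℝ) / 147456) ≤ ((9 : ℝ) / 20) := by norm_num
    linarith [hwin.1, ht.2]
  have hEh := (fermiEnergyOf_of_pointBracketCheck facePt_CCOCK26_nH110_s3_lo_br (by norm_num) (by norm_num) (by norm_num) (ν := (9/20 : ℝ))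
    (by push_cast; exact ⟨le_rfl, le_rfl⟩)).2
  have hER := (fermiEnergyOf_of_pointBracketCheck facePt_CCOCK26_nH110_s3_R_br (by norm_num) (by norm_num) (by norm_num) (ν := (9/20 : ℝ))
    (by push_cast; exact ⟨le_rfl, le_rfl⟩)).2
  have hEv := (fermiEnergyOf_of_pointBracketCheck facePt_CCOCK26_nH110_s3_hi_br (by norm_num) (by norm_num) (by norm_num) (ν := (9/20 : ℝ))
    (by push_cast; exact ⟨le_rfl, le_rfl⟩)).2
  push_cast at hEh hER hEv
  exact dWeightFace_fermiEnergyOf_mem_Icc_of_mem_box3_num (Eh := ((559 : ℝ) / 400)) (ER := ((6707 : ℝ) / 5000)) (Ev := ((2349 : ℝ) / 2000))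
    (by norm_num) one_pos (by norm_num) (by norm_num) hΔn hbn hcn (by norm_num) (by norm_num) hVH hEh.2 (by norm_num)
    (by norm_num [faceU, fsD, fsN, cA]) (by norm_num [faceU, fsD, fsN, cA]) (by norm_num [faceU, fsD, fsN, cA]) (by norm_num [faceU, fsD, fsN, cA])
    hER.1 (by norm_num) hEv.1 (by norm_num) (by norm_num) (by norm_num [faceG])
    (by norm_num [dWeightFaceCF, faceN, faceR, fsN]) (by norm_num [dWeightFaceCF, faceN, faceR, fsN])

/-- **`emeryBoxCCOCK26Src (EmeryBoxesKSlicesB)`, ν = 9/20: for EVERY member θ the Cu-d weight of the antinodal Fermi-surface state lies in `[0.676, 0.7664]`** (hull of the 3 t_pd slab windows). [folklore] -/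
theorem cCOCK26Box_dWeightFace_nH110 {Δ a b c : ℝ} (hΔ : Δ ∈ Icc ((41 : ℝ) / 20) ((133 : ℝ) / 50)) (ha : a ∈ Icc ((117 : ℝ) / 100) ((139 : ℝ) / 100)) (hb : b ∈ Icc ((29 : ℝ) / 50) ((69 : ℝ) / 100)) (hc : c ∈ Icc ((13 : ℝ) / 100) ((17 : ℝ) / 125)) :
    dWeightFace Δ a b c (fermiEnergyOf Δ a b c ((9 : ℝ) / 20)) ∈ Icc ((169 : ℝ) / 250) ((479 : ℝ) / 625) := by
  rcases le_or_gt a ((31 : ℝ) / 25) with h1 | h1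
  · have h := cCOCK26Box_dWeightFace_nH110_s1 hΔ ⟨ha.1, h1⟩ hb hc
    exact ⟨le_trans (by norm_num) h.1, le_trans h.2 (by norm_num)⟩
  · rcases le_or_gt a ((131 : ℝ) / 100) with h2 | h2
    · have h := cCOCK26Box_dWeightFace_nH110_s2 hΔ ⟨h1.le, h2⟩ hb hc
      exact ⟨le_trans (by norm_num) h.1, le_trans h.2 (by norm_num)⟩
    · have h := cCOCK26Box_dWeightFace_nH110_s3 hΔ ⟨h2.le, ha.2⟩ hb hc
      exact ⟨le_trans (by norm_num) h.1, le_trans h.2 (by norm_num)⟩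

end Summit.Ventures.CertifiedManyBodySolver.Downfold.Emery
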